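import Summits.SmoothPoincare4.SmoothPoincare4.Theses.OneStabInvertible

/-!
# OneStabInvertible — glue of the rev-2 split «Divides» of `StabOneSuffices`

Proves the glue item `StabOneSufficesGlue` (stmt-SmoothPoincare4-31040, support, rank 403) of
route-SmoothPoincare4-OneStabInvertible rev 2 (the split merged in from the superseded RootDecompW):
`DividesSphereProd → DividesImpOneStab → StabOneSuffices`
(stmt-SmoothPoincare4-29993 → 29994 → 13902).

Pure logic (modus ponens per homotopy 4-sphere `M`: `M` divides `S²×S²`, and dividing implies the one stabilisation
`M # S²×S² ≅ S²×S²`). Root decomposition cell decomp-sp4 (D-0178), LANDING LIST 2 (writer g6); 0 sorry.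
Nothing here proves `SmoothPoincare4`.
-/

set_option linter.dupNamespace false

namespace Summit.SmoothPoincare4.SmoothPoincare4.Theorems.OneStabInvertibleStabOneSufficesSplit

open Summit.SmoothPoincare4.SmoothPoincare4.Theses.OneStabInvertible

/-- Item stmt-SmoothPoincare4-31040: dividing `S²×S²` and «divides ⇒ one-stab» re-assemble the parent
`StabOneSuffices`. -/
theorem stabOneSufficesGlue_holds : StabOneSufficesGlue :=
  fun hD hI M _ _ _ _ _ e => hI M e (hD M e)

end Summit.SmoothPoincare4.SmoothPoincare4.Theorems.OneStabInvertibleStabOneSufficesSplit
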